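import Summits.CriticalPhenomena.CardyFormulaZ2.Theorems.CardyBoundaryCoulombGasHalfPlaneMarkDensityLawThreeArcLimit
import Summits.CriticalPhenomena.CardyFormulaZ2.Theorems.CardyBoundaryCoulombGasHalfPlaneMarkDensityLawThreeArcSelfDual
import Summits.CriticalPhenomena.CardyFormulaZ2.Theorems.CardyBoundaryCoulombGasHalfPlaneMarkDensityLawWiredOfJointLimit
import Summits.CriticalPhenomena.CardyFormulaZ2.Theorems.CardyBoundaryCoulombGasHalfPlaneMarkDensityLawWiredSelfDualConstraint

/-!
# `HalfPlaneMarkDensityLaw` (crux stmt-CriticalPhenomena-5661), line `Sketch`, cycle 9 (`WiredDual`, continued), lead c12-0: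
# assembly — **FINITE-ARC SELF-DUALITY OF EVERY JOINT SUBSEQUENTIAL LIMIT**

For a joint subsequential limit `G` of the half-plane four-arc crossing probability of critical bond-`ℤ²` along a strictly
increasing `θ` and `a < b < c`: the three-arc limit `G₃(a,b,c) = lim_{y→∞} G(a,b,c,y)` exists and is the wired limit
`W_G(c−b, b−a)` (`stub_threeArc_limit`), and **`G₃(a,b,c) + G₃(a, a+c−b, c) = 1`** (`stub_threeArc_selfDual`): the limits of
`P[[⌊an⌋,⌊bn⌋]×{0} ↔ [⌊cn⌋,∞)×{0}]` at a split point `b` of `[a,c]` and at the complementary split point `a+c−b` sum to one —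
unconditionally, along every subsequence (Cardy: `F(u) + F(1−u) = 1`, `u = (b−a)/(c−a)`).  In particular the midpoint split
has limit `1/2` (`threeArc_midpoint`).
-/

noncomputable section

namespace Summit.CriticalPhenomena.CardyFormulaZ2.Cruxes.HalfPlaneMarkDensityLaw.SketchLine

open Literature.Probability.Percolation Literature.Probability.LatticeModels
open MeasureTheory Filter Set
open scoped Topology
open Summit.CriticalPhenomena.CardyFormulaZ2.Theorems.HalfPlaneMarkDensityLaw.Negative

namespace WiredDual

/-- **T1. The three-arc limit exists and equals the wired limit `W_G(c−b, b−a)`.** [folklore] -/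
theorem stub_threeArc_limit :
    ∀ {θ : ℕ → ℕ} {G : ℝ → ℝ → ℝ → ℝ → ℝ}, (∀ a b c y : ℝ, a < b → b < c → c < y → Tendsto (fun n ↦ μ.real (openCrossing halfPlane (arcA a b (θ n)) (rowIcc ⌊c * (θ n : ℕ)⌋ ⌊y * (θ n : ℕ)⌋))) atTop (𝓝 (G a b c y))) → StrictMono θ → ∀ a b c : ℝ, a < b → b < c → ∃ L : ℝ, Tendsto (fun y : ℝ ↦ G a b c y) atTop (𝓝 L) ∧ Tendsto (fun M : ℕ ↦ G (-(M : ℝ)) (-(c - b)) ((M : ℝ)⁻¹) (b - a)) atTop (𝓝 L) :=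
  stub_threeArc_limit_of stub_wired_of_jointLimit

/-- **T2. Finite-arc self-duality: `G₃(a,b,c) + G₃(a, a+c−b, c) = 1`.** [folklore] -/
theorem stub_threeArc_selfDual :
    ∀ {θ : ℕ → ℕ} {G : ℝ → ℝ → ℝ → ℝ → ℝ}, (∀ a b c y : ℝ, a < b → b < c → c < y → Tendsto (fun n ↦ μ.real (openCrossing halfPlane (arcA a b (θ n)) (rowIcc ⌊c * (θ n : ℕ)⌋ ⌊y * (θ n : ℕ)⌋))) atTop (𝓝 (G a b c y))) → StrictMono θ → ∀ a b c : ℝ, a < b → b < c → ∀ L₁ L₂ : ℝ, Tendsto (fun y : ℝ ↦ G a b c y) atTop (𝓝 L₁) → Tendsto (fun y : ℝ ↦ G a (a + (c - b)) c y) atTop (𝓝 L₂) → L₁ + L₂ = 1 :=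
  stub_threeArc_selfDual_of stub_threeArc_limit (stub_jointLimit_selfDualConstraint_of stub_wired_of_jointLimit)

/-- **The midpoint split has three-arc limit `1/2`**: `lim_{y→∞} G(a, (a+c)/2, c, y) = 1/2` for every joint
subsequential limit and all `a < c`. [folklore] -/
theorem threeArc_midpoint {θ : ℕ → ℕ} {G : ℝ → ℝ → ℝ → ℝ → ℝ}
    (hG : ∀ a b c y : ℝ, a < b → b < c → c < y →
      Tendsto (fun n ↦ μ.real (openCrossing halfPlane (arcA a b (θ n))
        (rowIcc ⌊c * (θ n : ℕ)⌋ ⌊y * (θ n : ℕ)⌋))) atTop (𝓝 (G a b c y)))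
    (hθ : StrictMono θ) {a c : ℝ} (hac : a < c) :
    Tendsto (fun y : ℝ ↦ G a ((a + c) / 2) c y) atTop (𝓝 (1 / 2)) := by
  have hab : a < (a + c) / 2 := by linarith
  have hbc : (a + c) / 2 < c := by linarith
  obtain ⟨L, hL, -⟩ := stub_threeArc_limit hG hθ a ((a + c) / 2) c hab hbc
  have hmid : a + (c - (a + c) / 2) = (a + c) / 2 := by ring
  have hL' : Tendsto (fun y : ℝ ↦ G a (a + (c - (a + c) / 2)) c y) atTop (𝓝 L) := by
    simpa only [hmid] using hL
  have h := stub_threeArc_selfDual hG hθ a ((a + c) / 2) c hab hbc L L hL hL'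
  have hLeq : L = 1 / 2 := by linarith
  rwa [hLeq] at hL

end WiredDual

end Summit.CriticalPhenomena.CardyFormulaZ2.Cruxes.HalfPlaneMarkDensityLaw.SketchLine
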